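import Mathlib
import Summits.CriticalPhenomena.Ising3DConformalLimit.Theorems.PrecisionLaplacianTwoPointSpineGlueHeavyBoxes
import HarnessLib

/-!
# TwoPointSpineGlue (route PrecisionLaplacian, item stmt-CriticalPhenomena-4805) — the Tauberian step, I:
# ray limits of a kernel that is Lipschitz at scale and has block scaling limits

Helper file 16.  Abstract setting on `ℤ³`: a function `G : ℤ³ → ℝ` which is LIPSCHITZ AT SCALE,
`|G(z') − G(z)| ≤ C ‖z' − z‖₁ ‖z‖_∞^{-(s+1)}` for `‖z‖_∞ ≥ 16`, `‖z' − z‖₁ ≤ ‖z‖_∞/2` (`s > 0`), and whose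
BLOCK SUMS over pairs of cubes `⌊Nw⌋ + Λ_{⌊δN⌋}`, `Λ_{⌊δN⌋}` have scaling limits
`N^{s-6} ∑_{u,u'} G(⌊Nw⌋ + u − u') → Λ(w,δ)`.  Then:

* `ray_compare` — nearby rays stay close at scale: for `‖w‖₂ ≥ ρ`, `‖w' − w‖₂ ≤ ρ/48` and `N` large,
  `N^s |G(⌊Nw'⌋) − G(⌊Nw⌋)| ≤ K_ρ (‖w' − w‖₂ + 4/N)`;
* `block_average_compare` — the block average around `⌊Nw⌋` is within `K_ρ' δ N^{-s}` of `G(⌊Nw⌋)`;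
* `ray_limit` — **the ray limits `k(w) = lim_N N^s G(⌊Nw⌋)` exist** for every `w ≠ 0` (the sequence is
  Cauchy: it is within `O(δ)` of the convergent rescaled block averages, for every small `δ`).

For the critical two-point function these inputs are `…TwoPointSpineGlueLipschitz.lipschitz_at_scale` and
`…TwoPointSpineGlueBlockLimit.block_scaling_limit`.  No definitions are introduced.
-/

noncomputable section

namespace Summit.CriticalPhenomena.Ising3DConformalLimit.Theorems.SpineGlue

open Finset Real Filter Topology Literature.Probability.LatticeModels

/-! ### Lattice approximations of rays -/

/-- The Euclidean norm of an embedded site is at most twice its sup norm. -/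
theorem norm_siteVec_le_two_mul (x : Site 3) : ‖siteVec x‖ ≤ 2 * ‖x‖ := by
  rw [EuclideanSpace.norm_eq]
  have hcoord : ∀ i, ‖(siteVec x) i‖ ^ 2 ≤ ‖x‖ ^ 2 := fun i => by
    have h : ‖(siteVec x) i‖ ≤ ‖x‖ := by
      rw [siteVec_apply, Int.norm_cast_real]; exact norm_le_pi_norm x i
    exact pow_le_pow_left₀ (norm_nonneg _) h 2
  calc Real.sqrt (∑ i, ‖(siteVec x) i‖ ^ 2) ≤ Real.sqrt (3 * ‖x‖ ^ 2) := by
        apply Real.sqrt_le_sqrt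
        calc ∑ i, ‖(siteVec x) i‖ ^ 2 ≤ ∑ _i : Fin 3, ‖x‖ ^ 2 := Finset.sum_le_sum fun i _ => hcoord i
          _ = 3 * ‖x‖ ^ 2 := by simp
    _ ≤ 2 * ‖x‖ := by
        rw [Real.sqrt_le_left (by positivity)]
        nlinarith [norm_nonneg x]

/-- The `ℓ¹` norm of a lattice vector is at most three times the Euclidean norm of its embedding. -/
theorem sum_abs_le_three_mul_norm_siteVec (d : Site 3) : (∑ l, |((d l : ℤ) : ℝ)|) ≤ 3 * ‖siteVec d‖ := by
  have h : ∀ l, |((d l : ℤ) : ℝ)| ≤ ‖siteVec d‖ := fun l => by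
    have h1 : |((d l : ℤ) : ℝ)| ≤ ‖d‖ := by
      have := norm_le_pi_norm d l; rwa [Int.norm_eq_abs] at this
    exact h1.trans (norm_le_norm_siteVec d)
  calc (∑ l, |((d l : ℤ) : ℝ)|) ≤ ∑ _l : Fin 3, ‖siteVec d‖ := Finset.sum_le_sum fun l _ => h l
    _ = 3 * ‖siteVec d‖ := by simp

/-- The sup norm of `⌊N w⌋` is at least `(N‖w‖₂ − 2)/2`. -/
theorem norm_latticeApprox_ge (N : ℕ) (w : EuclideanSpace ℝ (Fin 3)) :
    ((N : ℝ) * ‖w‖ - 2) / 2 ≤ ‖latticeApprox ((N : ℝ)⁻¹) w‖ := by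
  have h1 := norm_siteVec_latticeApprox_sub_le N w
  have h2 := norm_siteVec_le_two_mul (latticeApprox ((N : ℝ)⁻¹) w)
  have h3 : (N : ℝ) * ‖w‖ ≤ ‖siteVec (latticeApprox ((N : ℝ)⁻¹) w)‖ + 2 := by
    have := norm_sub_norm_le ((N : ℝ) • w) (siteVec (latticeApprox ((N : ℝ)⁻¹) w))
    rw [norm_sub_rev, norm_smul, Real.norm_natCast] at this
    linarith
  linarith

/-- The sup norm of `⌊N w⌋` is at most `N‖w‖₂ + 2`. -/
theorem norm_latticeApprox_le (N : ℕ) (w : EuclideanSpace ℝ (Fin 3)) :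
    ‖latticeApprox ((N : ℝ)⁻¹) w‖ ≤ (N : ℝ) * ‖w‖ + 2 := by
  have h1 := norm_siteVec_latticeApprox_sub_le N w
  have h2 := norm_le_norm_siteVec (latticeApprox ((N : ℝ)⁻¹) w)
  have h3 : ‖siteVec (latticeApprox ((N : ℝ)⁻¹) w)‖ ≤ (N : ℝ) * ‖w‖ + 2 := by
    have := norm_le_norm_add_norm_sub' (siteVec (latticeApprox ((N : ℝ)⁻¹) w)) ((N : ℝ) • w)
    rw [norm_smul, Real.norm_natCast] at this
    linarith
  linarith

/-- Lattice approximations of two rays are `ℓ¹`-close: `‖⌊Nw⌋ − ⌊Nw'⌋‖₁ ≤ 3(N‖w − w'‖₂ + 4)`. -/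
theorem sum_abs_latticeApprox_sub_le (N : ℕ) (w w' : EuclideanSpace ℝ (Fin 3)) :
    (∑ l, |(((latticeApprox ((N : ℝ)⁻¹) w' l - latticeApprox ((N : ℝ)⁻¹) w l : ℤ)) : ℝ)|)
      ≤ 3 * ((N : ℝ) * ‖w' - w‖ + 4) := by
  have h := sum_abs_le_three_mul_norm_siteVec (latticeApprox ((N : ℝ)⁻¹) w' - latticeApprox ((N : ℝ)⁻¹) w)
  have hdist : ‖siteVec (latticeApprox ((N : ℝ)⁻¹) w' - latticeApprox ((N : ℝ)⁻¹) w)‖ ≤ (N : ℝ) * ‖w' - w‖ + 4 := by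
    rw [siteVec_sub]
    have h1 := norm_siteVec_latticeApprox_sub_le N w
    have h2 := norm_siteVec_latticeApprox_sub_le N w'
    have hdecomp : siteVec (latticeApprox ((N : ℝ)⁻¹) w') - siteVec (latticeApprox ((N : ℝ)⁻¹) w)
        = (siteVec (latticeApprox ((N : ℝ)⁻¹) w') - (N : ℝ) • w') + (N : ℝ) • (w' - w)
          - (siteVec (latticeApprox ((N : ℝ)⁻¹) w) - (N : ℝ) • w) := by
      rw [smul_sub]; abel
    rw [hdecomp]
    calc ‖siteVec (latticeApprox ((N : ℝ)⁻¹) w') - (N : ℝ) • w' + (N : ℝ) • (w' - w)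
          - (siteVec (latticeApprox ((N : ℝ)⁻¹) w) - (N : ℝ) • w)‖
        ≤ ‖siteVec (latticeApprox ((N : ℝ)⁻¹) w') - (N : ℝ) • w' + (N : ℝ) • (w' - w)‖
          + ‖siteVec (latticeApprox ((N : ℝ)⁻¹) w) - (N : ℝ) • w‖ := norm_sub_le _ _
      _ ≤ (‖siteVec (latticeApprox ((N : ℝ)⁻¹) w') - (N : ℝ) • w'‖ + ‖(N : ℝ) • (w' - w)‖) + 2 :=
          add_le_add (norm_add_le _ _) h1
      _ ≤ (2 + (N : ℝ) * ‖w' - w‖) + 2 := by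
          rw [norm_smul, Real.norm_natCast]; linarith
      _ = (N : ℝ) * ‖w' - w‖ + 4 := by ring
  have : (∑ l, |(((latticeApprox ((N : ℝ)⁻¹) w' l - latticeApprox ((N : ℝ)⁻¹) w l : ℤ)) : ℝ)|)
      = ∑ l, |((((latticeApprox ((N : ℝ)⁻¹) w' - latticeApprox ((N : ℝ)⁻¹) w) l : ℤ)) : ℝ)| := by
    simp only [Pi.sub_apply]
  rw [this]
  linarith

/-! ### Rays stay close at scale -/

section Rays

variable {G : Site 3 → ℝ} {C s : ℝ}

/-- **Nearby rays stay close at scale.**  If `G` is Lipschitz at scale with constants `C, s`, then for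
`‖w‖₂ ≥ ρ > 0`, `‖w' − w‖₂ ≤ ρ/48` and `N ≥ max 200/ρ (4(R+?)…)` (here: `N ρ ≥ 200`):
`N^s |G(⌊Nw'⌋) − G(⌊Nw⌋)| ≤ 3 C (8/ρ)^{s+1} (‖w' − w‖₂ + 4/N)`. -/
theorem ray_compare (hs : 0 < s) (hC : 0 ≤ C)
    (hLip : ∀ z z' : Site 3, 16 ≤ ‖z‖ → (∑ l, |((z' l - z l : ℤ) : ℝ)|) ≤ ‖z‖ / 2 →
      |G z' - G z| ≤ C * (∑ l, |((z' l - z l : ℤ) : ℝ)|) * ‖z‖ ^ (-(s + 1)))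
    {ρ : ℝ} (hρ : 0 < ρ) {w w' : EuclideanSpace ℝ (Fin 3)} (hw : ρ ≤ ‖w‖) (hww' : ‖w' - w‖ ≤ ρ / 48)
    {N : ℕ} (hN : 200 ≤ (N : ℝ) * ρ) :
    (N : ℝ) ^ s * |G (latticeApprox ((N : ℝ)⁻¹) w') - G (latticeApprox ((N : ℝ)⁻¹) w)|
      ≤ 3 * C * (8 / ρ) ^ (s + 1) * (‖w' - w‖ + 4 / N) := by
  set z := latticeApprox ((N : ℝ)⁻¹) w with hz
  set z' := latticeApprox ((N : ℝ)⁻¹) w' with hz'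
  have hNρ : (0 : ℝ) < N * ρ := by linarith
  have hNpos : (0 : ℝ) < N := by
    rcases Nat.eq_zero_or_pos N with h | h
    · simp [h] at hN; linarith
    · exact_mod_cast h
  -- the norm of `z` at scale `N`
  have hz_ge : (N : ℝ) * ρ / 4 ≤ ‖z‖ := by
    have h := norm_latticeApprox_ge N w
    rw [← hz] at h
    have : (N : ℝ) * ρ ≤ (N : ℝ) * ‖w‖ := mul_le_mul_of_nonneg_left hw hNpos.le
    linarith
  have hz16 : 16 ≤ ‖z‖ := by linarith
  have hzpos : 0 < ‖z‖ := by linarith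
  -- the `ℓ¹` distance
  have hdist := sum_abs_latticeApprox_sub_le N w w'
  rw [← hz, ← hz'] at hdist
  have hdist' : (∑ l, |((z' l - z l : ℤ) : ℝ)|) ≤ ‖z‖ / 2 := by
    have h1 : (N : ℝ) * ‖w' - w‖ ≤ N * ρ / 48 := by
      have := mul_le_mul_of_nonneg_left hww' hNpos.le; linarith
    linarith
  have hmain := hLip z z' hz16 hdist'
  -- compare the powers of the norms
  have hpow : ‖z‖ ^ (-(s + 1)) ≤ (8 / ρ) ^ (s + 1) * (N : ℝ) ^ (-(s + 1)) := by
    have h1 : (N : ℝ) * ρ / 8 ≤ ‖z‖ := by linarith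
    have h := Real.rpow_le_rpow_of_nonpos (by positivity : 0 < (N : ℝ) * ρ / 8) h1 (by linarith : -(s + 1) ≤ 0)
    have heq : ((N : ℝ) * ρ / 8) ^ (-(s + 1)) = (8 / ρ) ^ (s + 1) * (N : ℝ) ^ (-(s + 1)) := by
      rw [show (N : ℝ) * ρ / 8 = (N : ℝ) * (ρ / 8) by ring, Real.mul_rpow hNpos.le (by positivity),
        Real.rpow_neg (by positivity : (0:ℝ) ≤ ρ / 8), ← Real.inv_rpow (by positivity : (0:ℝ) ≤ ρ / 8), inv_div]
      ring
    rw [heq] at h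
    exact h
  -- assemble
  have hsum_nn : 0 ≤ ∑ l, |((z' l - z l : ℤ) : ℝ)| := Finset.sum_nonneg fun l _ => abs_nonneg _
  calc (N : ℝ) ^ s * |G z' - G z|
      ≤ (N : ℝ) ^ s * (C * (∑ l, |((z' l - z l : ℤ) : ℝ)|) * ‖z‖ ^ (-(s + 1))) :=
        mul_le_mul_of_nonneg_left hmain (Real.rpow_nonneg hNpos.le _)
    _ ≤ (N : ℝ) ^ s * (C * (3 * ((N : ℝ) * ‖w' - w‖ + 4)) * ((8 / ρ) ^ (s + 1) * (N : ℝ) ^ (-(s + 1)))) := by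
        gcongr
    _ = 3 * C * (8 / ρ) ^ (s + 1) * (((N : ℝ) * ‖w' - w‖ + 4) * ((N : ℝ) ^ s * (N : ℝ) ^ (-(s + 1)))) := by
        ring
    _ = 3 * C * (8 / ρ) ^ (s + 1) * (‖w' - w‖ + 4 / N) := by
        have : (N : ℝ) ^ s * (N : ℝ) ^ (-(s + 1)) = (N : ℝ)⁻¹ := by
          rw [← Real.rpow_add hNpos, show s + -(s + 1) = -1 by ring, Real.rpow_neg_one]
        rw [this]
        field_simp

/-- **The block average stays close to the centre value at scale.**  For `‖w‖₂ ≥ ρ`, `0 < δ ≤ ρ/48` and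
`N ρ ≥ 200`, every `G(⌊Nw⌋ + u − u')` with `u, u' ∈ Λ_{⌊δN⌋}` is within `6C (8/ρ)^{s+1} δ N^{-s}` of
`G(⌊Nw⌋)`. -/
theorem block_point_compare (hs : 0 < s) (hC : 0 ≤ C)
    (hLip : ∀ z z' : Site 3, 16 ≤ ‖z‖ → (∑ l, |((z' l - z l : ℤ) : ℝ)|) ≤ ‖z‖ / 2 →
      |G z' - G z| ≤ C * (∑ l, |((z' l - z l : ℤ) : ℝ)|) * ‖z‖ ^ (-(s + 1)))
    {ρ : ℝ} (hρ : 0 < ρ) {w : EuclideanSpace ℝ (Fin 3)} (hw : ρ ≤ ‖w‖) {δ : ℝ} (hδ : 0 < δ) (hδρ : δ ≤ ρ / 48)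
    {N : ℕ} (hN : 200 ≤ (N : ℝ) * ρ) {u u' : Site 3} (hu : u ∈ box 3 ⌊δ * N⌋₊) (hu' : u' ∈ box 3 ⌊δ * N⌋₊) :
    (N : ℝ) ^ s * |G (latticeApprox ((N : ℝ)⁻¹) w + u - u') - G (latticeApprox ((N : ℝ)⁻¹) w)|
      ≤ 6 * C * (8 / ρ) ^ (s + 1) * δ := by
  set z := latticeApprox ((N : ℝ)⁻¹) w with hz
  have hNρ : (0 : ℝ) < N * ρ := by linarith
  have hNpos : (0 : ℝ) < N := by
    rcases Nat.eq_zero_or_pos N with h | h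
    · simp [h] at hN; linarith
    · exact_mod_cast h
  have hz_ge : (N : ℝ) * ρ / 4 ≤ ‖z‖ := by
    have h := norm_latticeApprox_ge N w
    rw [← hz] at h
    have : (N : ℝ) * ρ ≤ (N : ℝ) * ‖w‖ := mul_le_mul_of_nonneg_left hw hNpos.le
    linarith
  have hz16 : 16 ≤ ‖z‖ := by linarith
  have hzpos : 0 < ‖z‖ := by linarith
  -- the `ℓ¹` distance is at most `6 δ N`
  have hM : (⌊δ * N⌋₊ : ℝ) ≤ δ * N := Nat.floor_le (by positivity)
  have hdist : (∑ l, |(((z + u - u') l - z l : ℤ) : ℝ)|) ≤ 6 * δ * N := by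
    have hcoord : ∀ l, |(((z + u - u') l - z l : ℤ) : ℝ)| ≤ 2 * (δ * N) := by
      intro l
      have h1 := (mem_box.1 hu) l
      have h2 := (mem_box.1 hu') l
      have : (z + u - u') l - z l = u l - u' l := by simp only [Pi.add_apply, Pi.sub_apply]; ring
      rw [this]
      have h3 : |((u l - u' l : ℤ) : ℝ)| ≤ 2 * ⌊δ * N⌋₊ := by
        rw [abs_le]; push_cast; constructor <;> linarith [(show ((u l : ℤ) : ℝ) ≤ ⌊δ * N⌋₊ from by exact_mod_cast h1.2),
          (show (-(⌊δ * N⌋₊ : ℝ)) ≤ ((u l : ℤ) : ℝ) from by exact_mod_cast h1.1),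
          (show ((u' l : ℤ) : ℝ) ≤ ⌊δ * N⌋₊ from by exact_mod_cast h2.2),
          (show (-(⌊δ * N⌋₊ : ℝ)) ≤ ((u' l : ℤ) : ℝ) from by exact_mod_cast h2.1)]
      linarith
    calc (∑ l, |(((z + u - u') l - z l : ℤ) : ℝ)|) ≤ ∑ _l : Fin 3, 2 * (δ * N) :=
          Finset.sum_le_sum fun l _ => hcoord l
      _ = 6 * δ * N := by simp; ring
  have hdist' : (∑ l, |(((z + u - u') l - z l : ℤ) : ℝ)|) ≤ ‖z‖ / 2 := by
    have : 6 * δ * N ≤ (N : ℝ) * ρ / 8 := by nlinarith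
    linarith
  have hmain := hLip z (z + u - u') hz16 hdist'
  have hpow : ‖z‖ ^ (-(s + 1)) ≤ (8 / ρ) ^ (s + 1) * (N : ℝ) ^ (-(s + 1)) := by
    have h1 : (N : ℝ) * ρ / 8 ≤ ‖z‖ := by linarith
    have h := Real.rpow_le_rpow_of_nonpos (by positivity : 0 < (N : ℝ) * ρ / 8) h1 (by linarith : -(s + 1) ≤ 0)
    have heq : ((N : ℝ) * ρ / 8) ^ (-(s + 1)) = (8 / ρ) ^ (s + 1) * (N : ℝ) ^ (-(s + 1)) := by
      rw [show (N : ℝ) * ρ / 8 = (N : ℝ) * (ρ / 8) by ring, Real.mul_rpow hNpos.le (by positivity),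
        Real.rpow_neg (by positivity : (0:ℝ) ≤ ρ / 8), ← Real.inv_rpow (by positivity : (0:ℝ) ≤ ρ / 8), inv_div]
      ring
    rw [heq] at h
    exact h
  have hsum_nn : 0 ≤ ∑ l, |(((z + u - u') l - z l : ℤ) : ℝ)| := Finset.sum_nonneg fun l _ => abs_nonneg _
  calc (N : ℝ) ^ s * |G (z + u - u') - G z|
      ≤ (N : ℝ) ^ s * (C * (∑ l, |(((z + u - u') l - z l : ℤ) : ℝ)|) * ‖z‖ ^ (-(s + 1))) :=
        mul_le_mul_of_nonneg_left hmain (Real.rpow_nonneg hNpos.le _)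
    _ ≤ (N : ℝ) ^ s * (C * (6 * δ * N) * ((8 / ρ) ^ (s + 1) * (N : ℝ) ^ (-(s + 1)))) := by gcongr
    _ = 6 * C * (8 / ρ) ^ (s + 1) * δ * ((N : ℝ) * ((N : ℝ) ^ s * (N : ℝ) ^ (-(s + 1)))) := by ring
    _ = 6 * C * (8 / ρ) ^ (s + 1) * δ := by
        have : (N : ℝ) ^ s * (N : ℝ) ^ (-(s + 1)) = (N : ℝ)⁻¹ := by
          rw [← Real.rpow_add hNpos, show s + -(s + 1) = -1 by ring, Real.rpow_neg_one]
        rw [this, mul_inv_cancel₀ hNpos.ne', mul_one]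

/-- `(2⌊δN⌋ + 1)/N → 2δ`. -/
theorem tendsto_card_side_div {δ : ℝ} (hδ : 0 < δ) :
    Tendsto (fun N : ℕ => (2 * (⌊δ * N⌋₊ : ℝ) + 1) / N) atTop (𝓝 (2 * δ)) := by
  have hinv : Tendsto (fun N : ℕ => (N : ℝ)⁻¹) atTop (𝓝 0) :=
    tendsto_inv_atTop_zero.comp tendsto_natCast_atTop_atTop
  refine tendsto_of_tendsto_of_tendsto_of_le_of_le' (g := fun N : ℕ => 2 * δ - (N : ℝ)⁻¹)
    (h := fun N : ℕ => 2 * δ + (N : ℝ)⁻¹) ?_ ?_ ?_ ?_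
  · simpa using tendsto_const_nhds.sub hinv
  · simpa using tendsto_const_nhds.add hinv
  · filter_upwards [eventually_ge_atTop 1] with N hN
    have hN : (0 : ℝ) < N := by exact_mod_cast hN
    have hfl : δ * N - 1 ≤ (⌊δ * N⌋₊ : ℝ) := by
      have := Nat.lt_floor_add_one (δ * N); linarith
    rw [le_div_iff₀ hN]
    have : (2 * δ - (N : ℝ)⁻¹) * N = 2 * δ * N - 1 := by field_simp
    rw [this]; linarith
  · filter_upwards [eventually_ge_atTop 1] with N hN
    have hN : (0 : ℝ) < N := by exact_mod_cast hN
    have hfl : (⌊δ * N⌋₊ : ℝ) ≤ δ * N := Nat.floor_le (by positivity)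
    rw [div_le_iff₀ hN]
    have : (2 * δ + (N : ℝ)⁻¹) * N = 2 * δ * N + 1 := by field_simp
    rw [this]; linarith

/-- **Ray limits exist.**  If `G` is Lipschitz at scale and its block sums around the ray `⌊N w⌋` have
scaling limits for every small `δ`, then `N^s G(⌊N w⌋)` converges (`w ≠ 0`): the sequence is within
`K δ` of the rescaled block averages, which converge; hence it is Cauchy. -/
theorem ray_limit (hs : 0 < s) (hC : 0 ≤ C)
    (hLip : ∀ z z' : Site 3, 16 ≤ ‖z‖ → (∑ l, |((z' l - z l : ℤ) : ℝ)|) ≤ ‖z‖ / 2 →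
      |G z' - G z| ≤ C * (∑ l, |((z' l - z l : ℤ) : ℝ)|) * ‖z‖ ^ (-(s + 1)))
    {w : EuclideanSpace ℝ (Fin 3)} (hw : w ≠ 0)
    (hΛ : ∀ δ : ℝ, 0 < δ → ∃ Λ : ℝ, Tendsto (fun N : ℕ => (N : ℝ) ^ (s - 6) *
      ∑ u ∈ box 3 ⌊δ * N⌋₊, ∑ u' ∈ box 3 ⌊δ * N⌋₊, G (latticeApprox ((N : ℝ)⁻¹) w + u - u'))
        atTop (𝓝 Λ)) :
    ∃ kw : ℝ, Tendsto (fun N : ℕ => (N : ℝ) ^ s * G (latticeApprox ((N : ℝ)⁻¹) w)) atTop (𝓝 kw) := by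
  set ρ : ℝ := ‖w‖ with hρ
  have hρ0 : 0 < ρ := norm_pos_iff.2 hw
  set K : ℝ := 6 * C * (8 / ρ) ^ (s + 1) with hK
  have hK0 : 0 ≤ K := by positivity
  set a : ℕ → ℝ := fun N => (N : ℝ) ^ s * G (latticeApprox ((N : ℝ)⁻¹) w) with ha
  -- the rescaled block averages
  set b : ℝ → ℕ → ℝ := fun δ N => (N : ℝ) ^ s * ((2 * (⌊δ * N⌋₊ : ℝ) + 1) ^ 6)⁻¹ *
    ∑ u ∈ box 3 ⌊δ * N⌋₊, ∑ u' ∈ box 3 ⌊δ * N⌋₊, G (latticeApprox ((N : ℝ)⁻¹) w + u - u') with hb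
  -- Claim 1: `|b δ N - a N| ≤ K δ` for `0 < δ ≤ ρ/48` and `N ρ ≥ 200`
  have hclose : ∀ δ : ℝ, 0 < δ → δ ≤ ρ / 48 → ∀ N : ℕ, 200 ≤ (N : ℝ) * ρ → |b δ N - a N| ≤ K * δ := by
    intro δ hδ hδρ N hN
    set M := ⌊δ * N⌋₊ with hM
    have hcard : ((box 3 M).card : ℝ) = (2 * (M : ℝ) + 1) ^ 3 := by
      rw [card_box]; push_cast; ring
    have hside : (0 : ℝ) < 2 * (M : ℝ) + 1 := by positivity
    have hsum1 : ∑ u ∈ box 3 M, ∑ u' ∈ box 3 M, (1 : ℝ) = (2 * (M : ℝ) + 1) ^ 6 := by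
      rw [Finset.sum_const, Finset.sum_const, nsmul_eq_mul, nsmul_eq_mul, mul_one, hcard]; ring
    -- `b - a` as an average of deviations
    have hdiff : b δ N - a N = ((2 * (M : ℝ) + 1) ^ 6)⁻¹ *
        ∑ u ∈ box 3 M, ∑ u' ∈ box 3 M, ((N : ℝ) ^ s *
          (G (latticeApprox ((N : ℝ)⁻¹) w + u - u') - G (latticeApprox ((N : ℝ)⁻¹) w))) := by
      simp only [hb, ha, ← hM]
      have h1 : ∑ u ∈ box 3 M, ∑ u' ∈ box 3 M, ((N : ℝ) ^ s *
          (G (latticeApprox ((N : ℝ)⁻¹) w + u - u') - G (latticeApprox ((N : ℝ)⁻¹) w)))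
          = (N : ℝ) ^ s * ∑ u ∈ box 3 M, ∑ u' ∈ box 3 M, G (latticeApprox ((N : ℝ)⁻¹) w + u - u')
            - (N : ℝ) ^ s * G (latticeApprox ((N : ℝ)⁻¹) w) * ∑ u ∈ box 3 M, ∑ u' ∈ box 3 M, (1 : ℝ) := by
        rw [Finset.mul_sum, Finset.mul_sum, ← Finset.sum_sub_distrib]
        refine Finset.sum_congr rfl fun u _ => ?_
        rw [Finset.mul_sum, Finset.mul_sum, ← Finset.sum_sub_distrib]
        refine Finset.sum_congr rfl fun u' _ => ?_
        ring
      rw [h1, hsum1]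
      field_simp
    rw [hdiff, abs_mul, abs_of_pos (by positivity)]
    have hterm : ∀ u ∈ box 3 M, ∀ u' ∈ box 3 M, |(N : ℝ) ^ s *
        (G (latticeApprox ((N : ℝ)⁻¹) w + u - u') - G (latticeApprox ((N : ℝ)⁻¹) w))| ≤ K * δ := by
      intro u hu u' hu'
      rw [abs_mul, abs_of_nonneg (Real.rpow_nonneg (Nat.cast_nonneg N) _)]
      exact block_point_compare hs hC hLip hρ0 (le_refl ρ) hδ hδρ hN hu hu'
    calc ((2 * (M : ℝ) + 1) ^ 6)⁻¹ * |∑ u ∈ box 3 M, ∑ u' ∈ box 3 M, ((N : ℝ) ^ s *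
          (G (latticeApprox ((N : ℝ)⁻¹) w + u - u') - G (latticeApprox ((N : ℝ)⁻¹) w)))|
        ≤ ((2 * (M : ℝ) + 1) ^ 6)⁻¹ * ∑ u ∈ box 3 M, ∑ u' ∈ box 3 M, K * δ := by
          refine mul_le_mul_of_nonneg_left ?_ (by positivity)
          refine (Finset.abs_sum_le_sum_abs _ _).trans (Finset.sum_le_sum fun u hu => ?_)
          exact (Finset.abs_sum_le_sum_abs _ _).trans (Finset.sum_le_sum fun u' hu' => hterm u hu u' hu')
      _ = K * δ := by
          rw [Finset.sum_const, Finset.sum_const, nsmul_eq_mul, nsmul_eq_mul, hcard]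
          field_simp
  -- Claim 2: `b δ` converges for every `δ > 0`
  have hbconv : ∀ δ : ℝ, 0 < δ → ∃ L : ℝ, Tendsto (b δ) atTop (𝓝 L) := by
    intro δ hδ
    obtain ⟨Λ, hΛδ⟩ := hΛ δ hδ
    have hratio : Tendsto (fun N : ℕ => ((N : ℝ) / (2 * (⌊δ * N⌋₊ : ℝ) + 1)) ^ 6) atTop
        (𝓝 ((2 * δ)⁻¹ ^ 6)) := by
      have h := (tendsto_card_side_div hδ).inv₀ (by positivity)
      refine (h.pow 6).congr' ?_
      filter_upwards [eventually_ge_atTop 1] with N hN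
      rw [inv_div]
    refine ⟨Λ * (2 * δ)⁻¹ ^ 6, (hΛδ.mul hratio).congr' ?_⟩
    filter_upwards [eventually_ge_atTop 1] with N hN
    have hNr : (0 : ℝ) < N := by exact_mod_cast hN
    simp only [hb]
    have hpow : (N : ℝ) ^ (s - 6) * (N : ℝ) ^ 6 = (N : ℝ) ^ s := by
      rw [← Real.rpow_natCast, ← Real.rpow_add hNr]; congr 1; push_cast; ring
    rw [div_pow, ← hpow]
    field_simp
  -- Cauchy
  have hcauchy : CauchySeq a := by
    rw [Metric.cauchySeq_iff]
    intro ε hε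
    set δ : ℝ := min (ρ / 48) (ε / (4 * K + 4)) with hδdef
    have hδ0 : 0 < δ := lt_min (by positivity) (by positivity)
    have hδρ : δ ≤ ρ / 48 := min_le_left _ _
    have hKδ : K * δ ≤ ε / 4 := by
      have h1 : δ ≤ ε / (4 * K + 4) := min_le_right _ _
      have h2 : K * δ ≤ K * (ε / (4 * K + 4)) := mul_le_mul_of_nonneg_left h1 hK0
      have h3 : K * (ε / (4 * K + 4)) ≤ ε / 4 := by
        rw [mul_div_assoc', div_le_div_iff₀ (by positivity) (by positivity)]
        nlinarith
      linarith
    obtain ⟨L, hL⟩ := hbconv δ hδ0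
    have hbC : CauchySeq (b δ) := hL.cauchySeq
    rw [Metric.cauchySeq_iff] at hbC
    obtain ⟨N₁, hN₁⟩ := hbC (ε / 4) (by positivity)
    obtain ⟨N₂, hN₂⟩ := exists_nat_ge (200 / ρ)
    refine ⟨max N₁ N₂, fun m hm n hn => ?_⟩
    have hmρ : 200 ≤ (m : ℝ) * ρ := by
      have : (N₂ : ℝ) ≤ m := by exact_mod_cast (le_max_right _ _).trans hm
      rw [div_le_iff₀ hρ0] at hN₂; nlinarith
    have hnρ : 200 ≤ (n : ℝ) * ρ := by
      have : (N₂ : ℝ) ≤ n := by exact_mod_cast (le_max_right _ _).trans hn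
      rw [div_le_iff₀ hρ0] at hN₂; nlinarith
    have h1 := hclose δ hδ0 hδρ m hmρ
    have h2 := hclose δ hδ0 hδρ n hnρ
    have h3 := hN₁ m ((le_max_left _ _).trans hm) n ((le_max_left _ _).trans hn)
    rw [Real.dist_eq] at h3 ⊢
    calc |a m - a n| = |(a m - b δ m) + (b δ m - b δ n) + (b δ n - a n)| := by ring_nf
      _ ≤ |a m - b δ m| + |b δ m - b δ n| + |b δ n - a n| := abs_add_three _ _ _
      _ < ε / 4 + ε / 4 + ε / 4 := by
          have e1 : |a m - b δ m| ≤ ε / 4 := by rw [abs_sub_comm]; exact h1.trans hKδ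
          have e2 : |b δ n - a n| ≤ ε / 4 := h2.trans hKδ
          linarith
      _ < ε := by linarith
  exact cauchySeq_tendsto_of_complete hcauchy

end Rays

end Summit.CriticalPhenomena.Ising3DConformalLimit.Theorems.SpineGlue

end
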